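import Summits.Ventures.PercRepro.S1CoreCapSevenChord

/-!
# PercRepro — TOWARDS `Q*(7) = 19`: TWO BIG LINES IN NO PLANE (p1, gen 26)

The open case B of S1CoreCapSevenCases, closed: two lines `L₁, L₂` of `≥ 4` points in no common duplicate-free
list of `lineRank ≤ 3` are disjoint (`disjoint_of_noncoplanar`: meeting lines form `[L₂, L₁]` of rank `3`), and
over `P₀ = L₁ ∪ L₂` (cost `4 + fat P₀`, budget `3 − fat P₀` on free lines and new fat points) every other line has
at most one point on each big line — a CHORD (two points on `P₀`, one hub off it) or a THIN line; two chords
through one hub `v` would make `[L₂, L₁, c′, c]` a list of rank `2 + 1 + 0 + 0 = 3` containing both big lines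
(`chord_unique_of_noncoplanar`), so the fat counting lemma with chords applies (S1CoreCapSevenChord): cap
`≤ |L₁| + |L₂| + fat P₀ + b (b + 1) / 2 + fat P₀ · b ≤ 14` (`sum_cap_le_nineteen_of_two_big_noncoplanar`).
`proofs/P1-S4-CAPBRIDGE.md` §18 (B). Axioms: standard.
-/

namespace PercRepro

namespace S1

namespace FourCap

namespace Seven

variable {β : Type} [DecidableEq β]


section TwoBigNoncoplanar

variable {w : β → ℕ} {ls : Finset (Finset β)}
  (h1 : ∀ L ∈ ls, ∀ v ∈ L, w v = 1 ∨ w v = 2)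
  (h2 : ∀ L ∈ ls, 3 ≤ L.card ∧ wsum w L ≤ 5)
  (h3 : ∀ L ∈ ls, ∀ L' ∈ ls, L ≠ L' → (L ∩ L').card ≤ 1)
  (h4 : ∀ l : List (Finset β), l.Nodup → (∀ L ∈ l, L ∈ ls) → wsum w (unionL l) ≤ 7 + lineRank l)
  {L₁ L₂ : Finset β} (hL₁ : L₁ ∈ ls) (hL₂ : L₂ ∈ ls) (h12 : L₂ ≠ L₁)
  (c1 : 4 ≤ L₁.card) (c2 : 4 ≤ L₂.card)
  (hrest : ∀ L ∈ ls, L ≠ L₁ → L ≠ L₂ → L.card = 3)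
  (hnc : ¬ ∃ l : List (Finset β), l.Nodup ∧ (∀ L ∈ l, L ∈ ls) ∧ lineRank l ≤ 3 ∧ L₁ ∈ l ∧ L₂ ∈ l)

include h3 hL₁ hL₂ h12 c1 c2 hnc in
/-- Two big lines in no plane are disjoint. -/
theorem disjoint_of_noncoplanar : (L₂ ∩ L₁).card = 0 := by
  by_contra hne
  have hint : (L₂ ∩ L₁).card = 1 := by have := h3 L₂ hL₂ L₁ hL₁ h12; omega
  exact hnc ⟨[L₂, L₁], by simp [h12], by simp [hL₁, hL₂],
    (lineRank_pair_eq_three (by omega) (by omega) hint).le, by simp, by simp⟩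

include h3 hL₁ hL₂ h12 c1 c2 hrest hnc in
/-- **At most one chord per hub**: two distinct 3-point lines through a point `v ∉ L₁ ∪ L₂`, each with two points
on `L₁ ∪ L₂`, would put `L₁` and `L₂` in the plane `[L₂, L₁, c′, c]`. -/
theorem chord_unique_of_noncoplanar {v : β} (hv : v ∉ L₁ ∪ L₂) {c c' : Finset β} (hc : c ∈ ls) (hc' : c' ∈ ls)
    (hc1 : c ≠ L₁) (hc2 : c ≠ L₂) (hc1' : c' ≠ L₁) (hc2' : c' ≠ L₂) (hvc : v ∈ c) (hvc' : v ∈ c')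
    (hcP : (c ∩ (L₁ ∪ L₂)).card = 2) (hcP' : (c' ∩ (L₁ ∪ L₂)).card = 2) : c = c' := by
  by_contra hne
  apply hnc
  refine ⟨[L₂, L₁, c', c], by simp [h12, hc2'.symm, hc2.symm, hc1'.symm, hc1.symm, Ne.symm hne],
    by simp [hL₁, hL₂, hc, hc'], ?_, by simp, by simp⟩
  have hcc' := h3 c hc c' hc' hne
  have h3c := hrest c hc hc1 hc2
  have h3c' := hrest c' hc' hc1' hc2'
  have hdisj := disjoint_of_noncoplanar h3 hL₁ hL₂ h12 c1 c2 hnc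
  -- the points of the chords on the big lines
  have i1 : (c ∩ L₁).card ≤ 1 := h3 c hc L₁ hL₁ hc1
  have i2 : (c ∩ L₂).card ≤ 1 := h3 c hc L₂ hL₂ hc2
  have i1' : (c' ∩ L₁).card ≤ 1 := h3 c' hc' L₁ hL₁ hc1'
  have i2' : (c' ∩ L₂).card ≤ 1 := h3 c' hc' L₂ hL₂ hc2'
  have hu := card_inter_union_le c L₁ L₂
  have hu' := card_inter_union_le c' L₁ L₂
  have e1 : (c ∩ L₁).card = 1 := by omega
  have e2 : (c ∩ L₂).card = 1 := by omega
  have e1' : (c' ∩ L₁).card = 1 := by omega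
  have e2' : (c' ∩ L₂).card = 1 := by omega
  -- `L₁` meets `c' ∪ c` in two points, `L₂` meets `L₁ ∪ c' ∪ c` in two points
  have hL₁old : 2 ≤ (L₁ ∩ (c' ∪ c)).card := by
    obtain ⟨x, hx⟩ := Finset.card_eq_one.1 e1
    obtain ⟨x', hx'⟩ := Finset.card_eq_one.1 e1'
    have hxc : x ∈ c ∩ L₁ := hx ▸ Finset.mem_singleton_self x
    have hxc' : x' ∈ c' ∩ L₁ := hx' ▸ Finset.mem_singleton_self x'
    have hxx' : x ≠ x' := by
      intro h
      subst h
      have hvx : v ≠ x := fun h => (Finset.mem_union_left _ (h ▸ (Finset.mem_inter.1 hxc).2)) |> hv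
      exact hvx (Finset.card_le_one.1 hcc' v (Finset.mem_inter.2 ⟨hvc, hvc'⟩) x
        (Finset.mem_inter.2 ⟨(Finset.mem_inter.1 hxc).1, (Finset.mem_inter.1 hxc').1⟩))
    have hsub : ({x, x'} : Finset β) ⊆ L₁ ∩ (c' ∪ c) := by
      intro y hy
      simp only [Finset.mem_insert, Finset.mem_singleton] at hy
      rcases hy with rfl | rfl
      · exact Finset.mem_inter.2 ⟨(Finset.mem_inter.1 hxc).2, Finset.mem_union_right _ (Finset.mem_inter.1 hxc).1⟩
      · exact Finset.mem_inter.2 ⟨(Finset.mem_inter.1 hxc').2, Finset.mem_union_left _ (Finset.mem_inter.1 hxc').1⟩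
    have := Finset.card_le_card hsub
    rw [Finset.card_pair hxx'] at this
    exact this
  have hL₂old : 2 ≤ (L₂ ∩ (L₁ ∪ (c' ∪ c))).card := by
    obtain ⟨y, hy⟩ := Finset.card_eq_one.1 e2
    obtain ⟨y', hy'⟩ := Finset.card_eq_one.1 e2'
    have hyc : y ∈ c ∩ L₂ := hy ▸ Finset.mem_singleton_self y
    have hyc' : y' ∈ c' ∩ L₂ := hy' ▸ Finset.mem_singleton_self y'
    have hyy' : y ≠ y' := by
      intro h
      subst h
      have hvy : v ≠ y := fun h => (Finset.mem_union_right _ (h ▸ (Finset.mem_inter.1 hyc).2)) |> hv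
      exact hvy (Finset.card_le_one.1 hcc' v (Finset.mem_inter.2 ⟨hvc, hvc'⟩) y
        (Finset.mem_inter.2 ⟨(Finset.mem_inter.1 hyc).1, (Finset.mem_inter.1 hyc').1⟩))
    have hsub : ({y, y'} : Finset β) ⊆ L₂ ∩ (L₁ ∪ (c' ∪ c)) := by
      intro z hz
      simp only [Finset.mem_insert, Finset.mem_singleton] at hz
      rcases hz with rfl | rfl
      · exact Finset.mem_inter.2 ⟨(Finset.mem_inter.1 hyc).2,
          Finset.mem_union_right _ (Finset.mem_union_right _ (Finset.mem_inter.1 hyc).1)⟩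
      · exact Finset.mem_inter.2 ⟨(Finset.mem_inter.1 hyc').2,
          Finset.mem_union_right _ (Finset.mem_union_left _ (Finset.mem_inter.1 hyc').1)⟩
    have := Finset.card_le_card hsub
    rw [Finset.card_pair hyy'] at this
    exact this
  -- the rank of `[L₂, L₁, c', c]`
  have hcc'1 : (c' ∩ c).card = 1 := by
    have := h3 c' hc' c hc (Ne.symm hne)
    have : 1 ≤ (c' ∩ c).card := Finset.card_pos.2 ⟨v, Finset.mem_inter.2 ⟨hvc', hvc⟩⟩
    omega
  simp only [lineRank, unionL, Finset.union_empty, Finset.sdiff_empty, Finset.inter_empty, Finset.card_empty,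
    Nat.zero_add]
  have s1 := Finset.card_sdiff_add_card_inter c' c
  omega

include h1 h2 h3 h4 hL₁ hL₂ h12 c1 c2 hrest hnc in
/-- **Two big lines in no plane: cap sum `≤ 19`** (in fact `≤ 14`). -/
theorem sum_cap_le_nineteen_of_two_big_noncoplanar : ∑ L ∈ ls, capPaper L.card (fat w L) ≤ 19 := by
  have h2' := two_le_card_of_spec₇ h2
  have hdisj := disjoint_of_noncoplanar h3 hL₁ hL₂ h12 c1 c2 hnc
  set T := (ls.erase L₁).erase L₂ with hT
  have hTmem : ∀ L ∈ T, L ∈ ls ∧ L ≠ L₁ ∧ L ≠ L₂ := fun L hL => by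
    have h2'' := Finset.mem_erase.1 hL
    have h1' := Finset.mem_erase.1 h2''.2
    exact ⟨h1'.2, h1'.1, h2''.1⟩
  have hT3 : ∀ L ∈ T, L.card = 3 := fun L hL => hrest L (hTmem L hL).1 (hTmem L hL).2.1 (hTmem L hL).2.2
  -- the budget over `L₂ ∪ L₁`
  have hk : ∀ t : List (Finset β), t.Nodup → (∀ L ∈ t, L ∈ T) →
      freeCountR (L₂ ∪ L₁) t + fat w (unionLR (L₂ ∪ L₁) t \ (L₂ ∪ L₁)) + L₁.card + L₂.card + fat w L₁ +
        fat w L₂ ≤ 11 := by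
    intro t hndt hlt
    have hb := budget_of_prefix h1 h2' h4 [L₂, L₁] t (by
      rw [List.nodup_append']
      refine ⟨hndt, by simp [h12], fun L hLt hLl => ?_⟩
      simp only [List.mem_cons, List.not_mem_nil, or_false] at hLl
      rcases hLl with rfl | rfl
      · exact (hTmem L (hlt L hLt)).2.2 rfl
      · exact (hTmem L (hlt L hLt)).2.1 rfl)
      (fun L hL => by
        rcases List.mem_append.1 hL with hL | hL
        · exact (hTmem L (hlt L hL)).1
        · simp only [List.mem_cons, List.not_mem_nil, or_false] at hL
          rcases hL with rfl | rfl
          · exact hL₂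
          · exact hL₁)
      (fun L hL => hT3 L (hlt L hL))
    simp only [unionL, costSum, Finset.union_empty, Nat.zero_add, lineCost_empty] at hb
    rw [lineCost_of_inter_le_two (by omega)] at hb
    have hsplit := fat_sdiff_add_fat_of_subset w (subset_unionLR (L₂ ∪ L₁) t)
    have hdisj' : Disjoint L₂ L₁ := Finset.disjoint_iff_inter_eq_empty.2 (Finset.card_eq_zero.1 hdisj)
    have hf12 : fat w (L₂ ∪ L₁) = fat w L₂ + fat w L₁ := by
      unfold fat
      rw [Finset.filter_union, Finset.card_union_of_disjoint (Finset.disjoint_filter_filter hdisj')]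
    have hsd : L₂ \ L₁ = L₂ := Finset.sdiff_eq_self_of_disjoint hdisj'
    rw [hsd] at hb
    omega
  -- the family with chords
  have hthin := two_mul_sum_cap_chord_le w (L₂ ∪ L₁) T (b := 11 - L₁.card - L₂.card - fat w L₁ - fat w L₂)
    (fun L hL => ⟨hT3 L hL, by
      have := card_inter_union_le L L₂ L₁
      have := h3 L (hTmem L hL).1 L₂ hL₂ (hTmem L hL).2.2
      have := h3 L (hTmem L hL).1 L₁ hL₁ (hTmem L hL).2.1
      omega⟩)
    (fun L hL L' hL' hne => h3 L (hTmem L hL).1 L' (hTmem L' hL').1 hne)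
    (fun v hv L hL L' hL' hvL hvL' hLP hL'P => by
      rw [Finset.union_comm] at hv hLP hL'P
      exact chord_unique_of_noncoplanar h3 hL₁ hL₂ h12 c1 c2 hrest hnc hv (hTmem L hL).1 (hTmem L' hL').1
        (hTmem L hL).2.1 (hTmem L hL).2.2 (hTmem L' hL').2.1 (hTmem L' hL').2.2 hvL hvL' hLP hL'P)
    (fun L hL => h1 L (hTmem L hL).1) (fun L hL => (h2 L (hTmem L hL).1).2)
    (fun t hndt hlt => by have := hk t hndt hlt; omega)
  -- the sum
  have hsum := Finset.add_sum_erase ls (fun L => capPaper L.card (fat w L)) hL₁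
  have hsum' := Finset.add_sum_erase (ls.erase L₁) (fun L => capPaper L.card (fat w L))
    (Finset.mem_erase.2 ⟨h12, hL₂⟩)
  rw [← hT] at hsum'
  rw [← hsum, ← hsum']
  have hcap1 := capPaper_big_eq h1 h2 hL₁ c1
  have hcap2 := capPaper_big_eq h1 h2 hL₂ c2
  rw [hcap1, hcap2]
  have hw1 := (h2 L₁ hL₁).2
  have hw2 := (h2 L₂ hL₂).2
  have hwa := wsum_eq_card_add_fat w L₁ (h1 L₁ hL₁)
  have hwb := wsum_eq_card_add_fat w L₂ (h1 L₂ hL₂)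
  have hdisj' : Disjoint L₂ L₁ := Finset.disjoint_iff_inter_eq_empty.2 (Finset.card_eq_zero.1 hdisj)
  have hf12 : fat w (L₂ ∪ L₁) = fat w L₂ + fat w L₁ := by
    unfold fat
    rw [Finset.filter_union, Finset.card_union_of_disjoint (Finset.disjoint_filter_filter hdisj')]
  rw [hf12] at hthin
  have hs1 : (L₁.card = 4 ∧ fat w L₁ = 0) ∨ (L₁.card = 5 ∧ fat w L₁ = 0) ∨ (L₁.card = 4 ∧ fat w L₁ = 1) := by
    omega
  have hs2 : (L₂.card = 4 ∧ fat w L₂ = 0) ∨ (L₂.card = 5 ∧ fat w L₂ = 0) ∨ (L₂.card = 4 ∧ fat w L₂ = 1) := by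
    omega
  rcases hs1 with ⟨hk1, ha⟩ | ⟨hk1, ha⟩ | ⟨hk1, ha⟩ <;> rcases hs2 with ⟨hk2, hb⟩ | ⟨hk2, hb⟩ | ⟨hk2, hb⟩ <;>
    rw [hk1, hk2, ha, hb] at hthin ⊢ <;> omega

end TwoBigNoncoplanar

end Seven

end FourCap

end S1

end PercRepro
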